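import Literature.NumberTheory.LFunctions.ConreyIwaniec2002Thm61GenericIdentity
import Literature.NumberTheory.LFunctions.ConreyIwaniec2002Thm61GenericBounds
import Literature.NumberTheory.LFunctions.ConreyIwaniec2002Thm61OffDiagSeries
import HarnessLib

/-!
# Conrey–Iwaniec (2002), Theorem 6.1, (6.7)–(6.12): the off-diagonal pair sums

B. Conrey, H. Iwaniec, Acta Arith. 103 (2002) 259–312, §6 [held text `paper:arxiv-math_0111012`,
p0014:L90–L120]: "`𝒜′(T) ≪ ΣΣ_{m>n}(|a_m|² + |a_n|²)(1 + (m−n)T/n)⁻²` … `≪ G + T⁻¹G₁` (6.7) …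
`S*(h) = Σ_n a_{n+h} ā_n L(hT/n)` (6.9) … `S*(h) ≪ Σ_n(|a_{n+h}|² + |a_n|²)(n/hT)² ≤ 2(hT)⁻²G₂`
(6.10) … Inserting (6.10) into (6.8) we get (6.12)."

PROVED HERE (namespace `ConreyIwaniec2002.Thm61GenericPart`; third of four files towards the
registered sub-stub S2a `stub_thm61_generic` of SKELETON P64, line `thm61-cm-convolution`), for
`a 0 = 0`, `G₂ = Σ n²|a_n|² < ∞`, `T > 0`, all sums over `(h−1, n−1) ∈ ℕ × ℕ`:
* `tsum_W_le`, `tsum_pair_weight_le` — **(6.7) summed** (with the row sum `Σ_{h≥1}(1+hT/n)⁻² ≤ n/T`,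
  so without the source's extra `G`): `Σ_{h,n≥1}|a_{n+h}||a_n|(1+hT/n)⁻² ≤ G₁/T`;
* `tsum_pair_tail_le` — **(6.10) summed over `h > H`**: `Σ|a_{n+h}||a_n|·4n²/(hT)² ≤ 4G₂/(T²H)`;
* `tsum_pair_le_sq`: `Σ_{h,n≥1}|a_{n+h}||a_n| ≤ (Σ|a_n|)²`;
* `summable_shiftedSum` ((6.9) converges absolutely), `summable_mainPair`,
  `sum_shiftedSum_eq_tsum_pair`: `Σ_{1≤h≤H} S*(h)` as one double series over `(h−1, n−1)`.
Young's inequality `2|a_m a_n| ≤ |a_m|² + |a_n|²` and reindexing by injections of `ℕ × ℕ` throughout.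

«The programme SEARCHES and TYPES; no claim about Landau–Siegel zeros, Theorems 1–2 of
arXiv:2211.02515 or a repaired Margin232 until a kernel theorem says so.»

## References
* [ConreyIwaniec2002] B. Conrey, H. Iwaniec, *Spacing of zeros of Hecke L-functions and the class
  number problem*, Acta Arith. 103 (2002) 259–312, arXiv:math/0111012: §5 (5.14)–(5.18), §6 (6.1)–(6.12).
-/

noncomputable section

open Complex MeasureTheory Set Filter Real Finset
open scoped ComplexConjugate

namespace Literature.NumberTheory.LFunctions

namespace ConreyIwaniec2002

namespace Thm61GenericPart

open KernelMellin (abs_ciL_le)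
open Thm61OffDiagSeries (abs_ciL_le_one)

/-! ### The three pair sums ((6.7), (6.10), the terms `n < h`) -/

section PairSums

variable {a : ℕ → ℂ} (ha0 : a 0 = 0) (hG : Summable fun n : ℕ => (n : ℝ) ^ 2 * ‖a n‖ ^ 2)
  {T : ℝ} (hT : 0 < T)
include ha0 hG hT

/-- The base family `W(n,k) = |a_{n+1}|²(1 + (k+1)T/(n+1))⁻²` is summable with
`Σ_{n,k} W ≤ G₁/T` (row sums `Σ_{k ≥ 1}(1 + kT/n)⁻² ≤ n/T`). [cite: ConreyIwaniec2002, §6 (6.7)] -/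
theorem tsum_W_le :
    Summable (fun p : ℕ × ℕ =>
        ‖a (p.1 + 1)‖ ^ 2 * ((1 + ((p.2 : ℝ) + 1) * T / ((p.1 : ℝ) + 1)) ^ 2)⁻¹) ∧
      ∑' p : ℕ × ℕ, ‖a (p.1 + 1)‖ ^ 2 * ((1 + ((p.2 : ℝ) + 1) * T / ((p.1 : ℝ) + 1)) ^ 2)⁻¹ ≤
        (∑' n : ℕ, (n : ℝ) * ‖a n‖ ^ 2) / T := by
  have hrow : ∀ n : ℕ, Summable (fun k : ℕ => ((1 + ((k : ℝ) + 1) * T / ((n : ℝ) + 1)) ^ 2)⁻¹) ∧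
      ∑' k : ℕ, ((1 + ((k : ℝ) + 1) * T / ((n : ℝ) + 1)) ^ 2)⁻¹ ≤ ((n : ℝ) + 1) / T := by
    intro n
    have hx : 0 < T / ((n : ℝ) + 1) := by positivity
    have h := tsum_inv_one_add_mul_sq_le hx
    have heq : (fun k : ℕ => ((1 + ((k : ℝ) + 1) * T / ((n : ℝ) + 1)) ^ 2)⁻¹) =
        fun k : ℕ => ((1 + ((k : ℝ) + 1) * (T / ((n : ℝ) + 1))) ^ 2)⁻¹ := by
      funext k; rw [mul_div_assoc]
    rw [heq]
    exact ⟨h.1, h.2.trans (le_of_eq (by rw [inv_div]))⟩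
  have hWnn : ∀ p : ℕ × ℕ,
      0 ≤ ‖a (p.1 + 1)‖ ^ 2 * ((1 + ((p.2 : ℝ) + 1) * T / ((p.1 : ℝ) + 1)) ^ 2)⁻¹ :=
    fun p => mul_nonneg (sq_nonneg _) (inv_nonneg.mpr (sq_nonneg _))
  have hrowW : ∀ n : ℕ, Summable fun k : ℕ =>
      ‖a (n + 1)‖ ^ 2 * ((1 + ((k : ℝ) + 1) * T / ((n : ℝ) + 1)) ^ 2)⁻¹ :=
    fun n => (hrow n).1.mul_left (‖a (n + 1)‖ ^ 2)
  have hrow_le : ∀ n : ℕ, ∑' k : ℕ, ‖a (n + 1)‖ ^ 2 * ((1 + ((k : ℝ) + 1) * T / ((n : ℝ) + 1)) ^ 2)⁻¹ ≤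
      ‖a (n + 1)‖ ^ 2 * (((n : ℝ) + 1) / T) := fun n => by
    rw [tsum_mul_left]
    exact mul_le_mul_of_nonneg_left (hrow n).2 (sq_nonneg _)
  have hG1 := summable_mul_norm_sq ha0 hG
  have hmaj : Summable fun n : ℕ => ‖a (n + 1)‖ ^ 2 * (((n : ℝ) + 1) / T) := by
    refine (((summable_nat_add_iff 1).mpr hG1).div_const T).congr fun n => ?_
    push_cast
    ring
  have hrows : Summable fun n : ℕ =>
      ∑' k : ℕ, ‖a (n + 1)‖ ^ 2 * ((1 + ((k : ℝ) + 1) * T / ((n : ℝ) + 1)) ^ 2)⁻¹ :=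
    Summable.of_nonneg_of_le (fun n => tsum_nonneg fun k => hWnn (n, k)) hrow_le hmaj
  have hW : Summable (fun p : ℕ × ℕ =>
      ‖a (p.1 + 1)‖ ^ 2 * ((1 + ((p.2 : ℝ) + 1) * T / ((p.1 : ℝ) + 1)) ^ 2)⁻¹) :=
    (summable_prod_of_nonneg hWnn).mpr ⟨hrowW, hrows⟩
  refine ⟨hW, ?_⟩
  rw [hW.tsum_prod]
  calc ∑' (n : ℕ) (k : ℕ), ‖a (n + 1)‖ ^ 2 * ((1 + ((k : ℝ) + 1) * T / ((n : ℝ) + 1)) ^ 2)⁻¹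
      ≤ ∑' n, ‖a (n + 1)‖ ^ 2 * (((n : ℝ) + 1) / T) := hrows.tsum_le_tsum hrow_le hmaj
    _ = (∑' n : ℕ, ((n : ℝ) + 1) * ‖a (n + 1)‖ ^ 2) / T := by
        rw [← tsum_div_const]
        exact tsum_congr fun n => by ring
    _ = (∑' n : ℕ, (n : ℝ) * ‖a n‖ ^ 2) / T := by
        congr 1
        rw [hG1.tsum_eq_zero_add]
        push_cast
        ring

/-- **(6.7) summed**: `Σ_{h,n ≥ 1} |a_{n+h}||a_n|(1 + hT/n)⁻² ≤ G₁/T` (Young's inequality, the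
weight is increasing in `n`, and the row sums of `tsum_W_le`); with summability.
[cite: ConreyIwaniec2002, §6 (6.7)] -/
theorem tsum_pair_weight_le :
    Summable (fun q : ℕ × ℕ => ‖a (q.2 + 1 + (q.1 + 1))‖ * ‖a (q.2 + 1)‖ *
        ((1 + ((q.1 : ℝ) + 1) * T / ((q.2 : ℝ) + 1)) ^ 2)⁻¹) ∧
      ∑' q : ℕ × ℕ, ‖a (q.2 + 1 + (q.1 + 1))‖ * ‖a (q.2 + 1)‖ *
          ((1 + ((q.1 : ℝ) + 1) * T / ((q.2 : ℝ) + 1)) ^ 2)⁻¹ ≤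
        (∑' n : ℕ, (n : ℝ) * ‖a n‖ ^ 2) / T := by
  set W : ℕ × ℕ → ℝ := fun p =>
    ‖a (p.1 + 1)‖ ^ 2 * ((1 + ((p.2 : ℝ) + 1) * T / ((p.1 : ℝ) + 1)) ^ 2)⁻¹ with hWdef
  obtain ⟨hW, hWle⟩ := tsum_W_le ha0 hG hT
  have hWnn : ∀ p, 0 ≤ W p := fun p => by positivity
  -- the two reindexings
  set j : ℕ × ℕ → ℕ × ℕ := fun q => (q.2 + q.1 + 1, q.1) with hj
  have hjinj : Function.Injective j := by
    intro q q' h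
    simp only [hj, Prod.mk.injEq] at h
    ext <;> omega
  have hswap : ∑' q : ℕ × ℕ, W (q.2, q.1) = ∑' p, W p := by
    have := (Equiv.prodComm ℕ ℕ).tsum_eq W
    simpa only [Equiv.prodComm_apply, Prod.swap] using this
  have hswap_s : Summable fun q : ℕ × ℕ => W (q.2, q.1) := by
    have := (Equiv.prodComm ℕ ℕ).summable_iff.mpr hW
    simpa only [Function.comp_def, Equiv.prodComm_apply, Prod.swap] using this
  have hjle : ∑' q, W (j q) ≤ ∑' p, W p := by
    simpa only [Function.comp_def] using tsum_comp_le_tsum_of_inj hW hWnn hjinj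
  have hjs : Summable fun q => W (j q) := hW.comp_injective hjinj
  -- pointwise Young
  have hpt : ∀ q : ℕ × ℕ, ‖a (q.2 + 1 + (q.1 + 1))‖ * ‖a (q.2 + 1)‖ *
      ((1 + ((q.1 : ℝ) + 1) * T / ((q.2 : ℝ) + 1)) ^ 2)⁻¹ ≤ (W (q.2, q.1) + W (j q)) / 2 := by
    intro q
    have e1 : q.2 + 1 + (q.1 + 1) = q.2 + q.1 + 1 + 1 := by omega
    simp only [hWdef, hj, e1]
    push_cast
    set w₁ : ℝ := ((1 + ((q.1 : ℝ) + 1) * T / ((q.2 : ℝ) + 1)) ^ 2)⁻¹ with hw₁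
    set w₂ : ℝ := ((1 + ((q.1 : ℝ) + 1) * T / ((q.2 : ℝ) + q.1 + 1 + 1)) ^ 2)⁻¹ with hw₂
    have hw₁₂ : w₁ ≤ w₂ := by
      rw [hw₁, hw₂]
      have hq2 : (0 : ℝ) < (q.2 : ℝ) + 1 := by positivity
      have hc : 0 ≤ ((q.1 : ℝ) + 1) * T := by positivity
      refine inv_anti₀ (by positivity) (pow_le_pow_left₀ (by positivity) ?_ 2)
      have : ((q.1 : ℝ) + 1) * T / ((q.2 : ℝ) + q.1 + 1 + 1) ≤ ((q.1 : ℝ) + 1) * T / ((q.2 : ℝ) + 1) :=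
        div_le_div_of_nonneg_left hc hq2 (by have := (Nat.cast_nonneg q.1 : (0:ℝ) ≤ q.1); linarith)
      linarith
    have hw₁nn : 0 ≤ w₁ := by positivity
    set A := ‖a (q.2 + q.1 + 1 + 1)‖
    set B := ‖a (q.2 + 1)‖
    have hA : 0 ≤ A := norm_nonneg _
    have hyoung : A * B ≤ (B ^ 2 + A ^ 2) / 2 := by nlinarith [sq_nonneg (A - B)]
    calc A * B * w₁ ≤ (B ^ 2 + A ^ 2) / 2 * w₁ := mul_le_mul_of_nonneg_right hyoung hw₁nn
      _ = (B ^ 2 * w₁ + A ^ 2 * w₁) / 2 := by ring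
      _ ≤ (B ^ 2 * w₁ + A ^ 2 * w₂) / 2 := by
          gcongr
  have hmaj : Summable fun q : ℕ × ℕ => (W (q.2, q.1) + W (j q)) / 2 := (hswap_s.add hjs).div_const 2
  refine ⟨Summable.of_nonneg_of_le (fun q => by positivity) hpt hmaj, ?_⟩
  calc _ ≤ ∑' q : ℕ × ℕ, (W (q.2, q.1) + W (j q)) / 2 :=
        Summable.tsum_le_tsum hpt (Summable.of_nonneg_of_le (fun q => by positivity) hpt hmaj) hmaj
    _ = ((∑' q : ℕ × ℕ, W (q.2, q.1)) + ∑' q, W (j q)) / 2 := by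
        rw [tsum_div_const, hswap_s.tsum_add hjs]
    _ ≤ ((∑' p, W p) + ∑' p, W p) / 2 :=
        div_le_div_of_nonneg_right (add_le_add hswap.le hjle) (by norm_num)
    _ = ∑' p, W p := by ring
    _ ≤ _ := hWle

omit ha0 in
/-- **(6.10) summed over `h > H`**: `Σ_{h > H, n ≥ 1} |a_{n+h}||a_n|·4n²/(hT)² ≤ 4G₂/(T²H)`
(`2|a_{n+h}a_n|n² ≤ n²|a_n|² + (n+h)²|a_{n+h}|²`, `Σ_{h>H}h⁻² ≤ 1/H`); with summability.
[cite: ConreyIwaniec2002, §6 (6.10)–(6.12)] -/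
theorem tsum_pair_tail_le {H : ℕ} (hH : 1 ≤ H) :
    Summable (fun q : ℕ × ℕ => ‖a (q.2 + 1 + (q.1 + 1))‖ * ‖a (q.2 + 1)‖ *
        (if H < q.1 + 1 then 4 * ((q.2 : ℝ) + 1) ^ 2 / ((((q.1 : ℝ) + 1)) * T) ^ 2 else 0)) ∧
      ∑' q : ℕ × ℕ, ‖a (q.2 + 1 + (q.1 + 1))‖ * ‖a (q.2 + 1)‖ *
          (if H < q.1 + 1 then 4 * ((q.2 : ℝ) + 1) ^ 2 / ((((q.1 : ℝ) + 1)) * T) ^ 2 else 0) ≤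
        4 * (∑' n : ℕ, (n : ℝ) ^ 2 * ‖a n‖ ^ 2) / (T ^ 2 * H) := by
  -- the base family `V(k, n) = 𝟙_{H<k+1}(k+1)⁻² · (n+1)²|a_{n+1}|²`
  set ι : ℕ → ℝ := fun k => if H < k + 1 then (((k : ℝ) + 1) ^ 2)⁻¹ else 0 with hι
  set g : ℕ → ℝ := fun n => ((n : ℝ) + 1) ^ 2 * ‖a (n + 1)‖ ^ 2 with hg
  obtain ⟨hιs, hιle⟩ := tsum_indicator_inv_sq_le hH
  have hιnn : ∀ k, 0 ≤ ι k := fun k => by simp only [hι]; split_ifs <;> positivity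
  have hgnn : ∀ n, 0 ≤ g n := fun n => by positivity
  have hgs : Summable g := by
    refine ((summable_nat_add_iff 1).mpr hG).congr fun n => ?_
    simp only [hg]; push_cast; ring
  have hgsum : ∑' n, g n = ∑' n : ℕ, (n : ℝ) ^ 2 * ‖a n‖ ^ 2 := by
    rw [hG.tsum_eq_zero_add]
    simp only [hg]; push_cast; ring
  set V : ℕ × ℕ → ℝ := fun p => ι p.1 * g p.2 with hV
  have hVs : Summable V := hιs.mul_of_nonneg hgs hιnn hgnn
  have hVnn : ∀ p, 0 ≤ V p := fun p => mul_nonneg (hιnn _) (hgnn _)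
  have hVsum : ∑' p, V p ≤ (H : ℝ)⁻¹ * ∑' n : ℕ, (n : ℝ) ^ 2 * ‖a n‖ ^ 2 := by
    rw [hV, ← hιs.tsum_mul_tsum hgs hVs, hgsum]
    exact mul_le_mul_of_nonneg_right hιle (tsum_nonneg fun n => by positivity)
  -- reindexing `q ↦ (q.1, q.2 + q.1 + 1)`
  set j : ℕ × ℕ → ℕ × ℕ := fun q => (q.1, q.2 + q.1 + 1) with hj
  have hjinj : Function.Injective j := by
    intro q q' h
    simp only [hj, Prod.mk.injEq] at h
    ext <;> omega
  have hjle : ∑' q, V (j q) ≤ ∑' p, V p := by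
    simpa only [Function.comp_def] using tsum_comp_le_tsum_of_inj hVs hVnn hjinj
  have hjs : Summable fun q => V (j q) := hVs.comp_injective hjinj
  -- pointwise
  have hpt : ∀ q : ℕ × ℕ, ‖a (q.2 + 1 + (q.1 + 1))‖ * ‖a (q.2 + 1)‖ *
      (if H < q.1 + 1 then 4 * ((q.2 : ℝ) + 1) ^ 2 / ((((q.1 : ℝ) + 1)) * T) ^ 2 else 0) ≤
        2 / T ^ 2 * (V q + V (j q)) := by
    intro q
    have e1 : q.2 + 1 + (q.1 + 1) = q.2 + q.1 + 1 + 1 := by omega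
    simp only [hV, hι, hg, hj, e1]
    split_ifs with hq
    · push_cast
      set A := ‖a (q.2 + q.1 + 1 + 1)‖
      set B := ‖a (q.2 + 1)‖
      set n : ℝ := (q.2 : ℝ) + 1
      set m : ℝ := (q.2 : ℝ) + q.1 + 1 + 1
      set k : ℝ := (q.1 : ℝ) + 1
      have hA : 0 ≤ A := norm_nonneg _
      have hB : 0 ≤ B := norm_nonneg _
      have hn : 0 < n := by positivity
      have hnm : n ≤ m := by
        simp only [n, m]; have := (Nat.cast_nonneg q.1 : (0:ℝ) ≤ q.1); linarith
      have hk : 0 < k := by positivity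
      have hyoung : A * B * n ^ 2 ≤ (n ^ 2 * B ^ 2 + m ^ 2 * A ^ 2) / 2 := by
        have h1 : A * B * n ^ 2 ≤ (n * B) * (m * A) := by
          nlinarith [mul_le_mul_of_nonneg_left hnm (by positivity : 0 ≤ A * B * n)]
        nlinarith [sq_nonneg (n * B - m * A)]
      have hkT : 0 < (k * T) ^ 2 := by positivity
      calc A * B * (4 * n ^ 2 / (k * T) ^ 2) = 4 / (k * T) ^ 2 * (A * B * n ^ 2) := by ring
        _ ≤ 4 / (k * T) ^ 2 * ((n ^ 2 * B ^ 2 + m ^ 2 * A ^ 2) / 2) :=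
            mul_le_mul_of_nonneg_left hyoung (by positivity)
        _ = 2 / T ^ 2 * ((k ^ 2)⁻¹ * (n ^ 2 * B ^ 2) + (k ^ 2)⁻¹ * (m ^ 2 * A ^ 2)) := by
            field_simp
            ring
    · simp
  have hmaj : Summable fun q : ℕ × ℕ => 2 / T ^ 2 * (V q + V (j q)) := (hVs.add hjs).mul_left _
  have hs : Summable (fun q : ℕ × ℕ => ‖a (q.2 + 1 + (q.1 + 1))‖ * ‖a (q.2 + 1)‖ *
      (if H < q.1 + 1 then 4 * ((q.2 : ℝ) + 1) ^ 2 / ((((q.1 : ℝ) + 1)) * T) ^ 2 else 0)) :=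
    Summable.of_nonneg_of_le (fun q => by split_ifs <;> positivity) hpt hmaj
  refine ⟨hs, ?_⟩
  calc _ ≤ ∑' q : ℕ × ℕ, 2 / T ^ 2 * (V q + V (j q)) := hs.tsum_le_tsum hpt hmaj
    _ = 2 / T ^ 2 * ((∑' q, V q) + ∑' q, V (j q)) := by rw [tsum_mul_left, hVs.tsum_add hjs]
    _ ≤ 2 / T ^ 2 * ((H : ℝ)⁻¹ * (∑' n : ℕ, (n : ℝ) ^ 2 * ‖a n‖ ^ 2) +
          (H : ℝ)⁻¹ * (∑' n : ℕ, (n : ℝ) ^ 2 * ‖a n‖ ^ 2)) := by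
        exact mul_le_mul_of_nonneg_left (add_le_add hVsum (hjle.trans hVsum)) (by positivity)
    _ = 4 * (∑' n : ℕ, (n : ℝ) ^ 2 * ‖a n‖ ^ 2) / (T ^ 2 * H) := by
        field_simp
        ring

omit hT in
/-- The crude count of all off-diagonal pairs: `Σ_{h,n ≥ 1} |a_{n+h}||a_n| ≤ (Σ|a_n|)²`; with
summability. [cite: ConreyIwaniec2002, §6 (6.10)–(6.12)] -/
theorem tsum_pair_le_sq :
    Summable (fun q : ℕ × ℕ => ‖a (q.2 + 1 + (q.1 + 1))‖ * ‖a (q.2 + 1)‖) ∧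
      ∑' q : ℕ × ℕ, ‖a (q.2 + 1 + (q.1 + 1))‖ * ‖a (q.2 + 1)‖ ≤ (∑' n : ℕ, ‖a n‖) ^ 2 := by
  have hs := summable_norm ha0 hG
  have hP : Summable fun p : ℕ × ℕ => ‖a p.1‖ * ‖a p.2‖ :=
    hs.mul_of_nonneg hs (fun _ => norm_nonneg _) (fun _ => norm_nonneg _)
  have hjinj : Function.Injective (fun q : ℕ × ℕ => (q.2 + 1 + (q.1 + 1), q.2 + 1)) := by
    intro q q' h
    simp only [Prod.mk.injEq] at h
    ext <;> omega
  have h1 : Summable (fun q : ℕ × ℕ => ‖a (q.2 + 1 + (q.1 + 1))‖ * ‖a (q.2 + 1)‖) := by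
    simpa only [Function.comp_def] using hP.comp_injective hjinj
  refine ⟨h1, ?_⟩
  calc ∑' q : ℕ × ℕ, ‖a (q.2 + 1 + (q.1 + 1))‖ * ‖a (q.2 + 1)‖
      ≤ ∑' p : ℕ × ℕ, ‖a p.1‖ * ‖a p.2‖ := by
        simpa only [Function.comp_def] using
          tsum_comp_le_tsum_of_inj hP (fun p => by positivity) hjinj
    _ = (∑' n : ℕ, ‖a n‖) ^ 2 := by rw [sq, hs.tsum_mul_tsum hs hP]

end PairSums


/-! ### `Σ_{h ≤ H} S*(h)` as a double series -/

section MainSum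

variable {K : ℝ → ℝ} (hK : IsCIKernel K) {a : ℕ → ℂ} (ha0 : a 0 = 0)
  (hG : Summable fun n : ℕ => (n : ℝ) ^ 2 * ‖a n‖ ^ 2) (T : ℝ)
include hK ha0 hG

/-- The series `S*(h) = Σ_n a_{n+h} ā_n L(hT/n)` (6.9) converges absolutely
(`2|a_{n+h}a_n| ≤ |a_{n+h}|² + |a_n|²`, `|L| ≤ 1`). [cite: ConreyIwaniec2002, §6 (6.9)] -/
theorem summable_shiftedSum (h : ℕ) :
    Summable fun n : ℕ => a (n + h) * conj (a n) * (ciL K (h * T / n) : ℂ) := by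
  have hs2 := summable_norm_sq ha0 hG
  have hmaj : Summable fun n : ℕ => (‖a (n + h)‖ ^ 2 + ‖a n‖ ^ 2) / 2 :=
    (((summable_nat_add_iff h).mpr hs2).add hs2).div_const 2
  refine Summable.of_norm_bounded hmaj (fun n => ?_)
  rw [norm_mul, norm_mul, Complex.norm_conj, Complex.norm_real, Real.norm_eq_abs]
  calc ‖a (n + h)‖ * ‖a n‖ * |ciL K (h * T / n)| ≤ ‖a (n + h)‖ * ‖a n‖ :=
        mul_le_of_le_one_right (by positivity) (abs_ciL_le_one hK _)
    _ ≤ (‖a (n + h)‖ ^ 2 + ‖a n‖ ^ 2) / 2 := by nlinarith [sq_nonneg (‖a (n + h)‖ - ‖a n‖)]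

/-- The truncated main term as a summable family over `(h−1, n−1) ∈ ℕ × ℕ`.
[cite: ConreyIwaniec2002, §6 (6.9), (6.12)] -/
theorem summable_mainPair (H : ℕ) :
    Summable fun q : ℕ × ℕ => if q.1 + 1 ≤ H then
      a (q.2 + 1 + (q.1 + 1)) * conj (a (q.2 + 1)) *
        (ciL K (((q.1 + 1 : ℕ) : ℝ) * T / ((q.2 + 1 : ℕ) : ℝ)) : ℂ) else 0 := by
  refine Summable.of_norm_bounded (tsum_pair_le_sq ha0 hG).1 (fun q => ?_)
  split_ifs
  · rw [norm_mul, norm_mul, Complex.norm_conj, Complex.norm_real, Real.norm_eq_abs]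
    exact mul_le_of_le_one_right (by positivity) (abs_ciL_le_one hK _)
  · rw [norm_zero]; positivity

/-- **`Σ_{1 ≤ h ≤ H} S*(h) = Σ_{(h−1,n−1) ∈ ℕ×ℕ} 𝟙_{h ≤ H} a_{n+h} ā_n L(hT/n)`** (the terms
`n = 0` vanish since `a₀ = 0`). [cite: ConreyIwaniec2002, §6 (6.9), (6.12)] -/
theorem sum_shiftedSum_eq_tsum_pair (H : ℕ) :
    ∑ h ∈ Finset.Icc 1 H, ∑' n : ℕ, a (n + h) * conj (a n) * (ciL K (h * T / n) : ℂ) =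
      ∑' q : ℕ × ℕ, if q.1 + 1 ≤ H then
        a (q.2 + 1 + (q.1 + 1)) * conj (a (q.2 + 1)) *
          (ciL K (((q.1 + 1 : ℕ) : ℝ) * T / ((q.2 + 1 : ℕ) : ℝ)) : ℂ) else 0 := by
  have hgs := summable_mainPair hK ha0 hG T H
  rw [hgs.tsum_prod]
  -- `Σ' k, Σ' n, g(k,n) = Σ_{k < H} Σ' n, b (k+1) (n+1)`
  have hinner : ∀ k : ℕ, (∑' n : ℕ, if k + 1 ≤ H then
      a (n + 1 + (k + 1)) * conj (a (n + 1)) *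
        (ciL K (((k + 1 : ℕ) : ℝ) * T / ((n + 1 : ℕ) : ℝ)) : ℂ) else 0) =
      if k + 1 ≤ H then ∑' n : ℕ, a (n + (k + 1)) * conj (a n) *
        (ciL K (((k + 1 : ℕ) : ℝ) * T / (n : ℝ)) : ℂ) else 0 := by
    intro k
    by_cases hk : k + 1 ≤ H
    · simp only [if_pos hk]
      rw [(summable_shiftedSum hK ha0 hG T (k + 1)).tsum_eq_zero_add]
      simp [ha0]
    · simp only [if_neg hk, tsum_zero]
  simp only [hinner]
  rw [tsum_eq_sum (s := Finset.range H) (fun k hk => by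
    rw [Finset.mem_range] at hk
    rw [if_neg (by omega)])]
  -- reindex `h = k + 1`
  symm
  refine Finset.sum_nbij' (fun k => k + 1) (fun h => h - 1) (fun k hk => ?_) (fun h hh => ?_)
    (fun k hk => ?_) (fun h hh => ?_) (fun k hk => ?_)
  · simp only [Finset.mem_range] at hk; simp only [Finset.mem_Icc]; omega
  · simp only [Finset.mem_Icc] at hh; simp only [Finset.mem_range]; omega
  · omega
  · simp only [Finset.mem_Icc] at hh; omega
  · simp only [Finset.mem_range] at hk
    rw [if_pos (by omega)]

end MainSum

end Thm61GenericPart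

end ConreyIwaniec2002

end Literature.NumberTheory.LFunctions

end
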